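/-
Copyright (c) 2026 the pub-hodgecm-mathlib formalisation cell (harness21).  Prover seat hodgecm-mathlib-K2E1-p04 (g2), Track B ∕ K2-LIT
(build stream 29), h413 = `stmt-HodgeConjecture-24833`, line `K2_E1_TraceFormulaBeta`; BY-NAME DEAL of the dealer K2E1-plan (g0)
2026-09-03T22:23:49Z (`K2E1SupercuspidalJacquetVanishingU2`), satellite 1 of 2: the Φ₂ torus-contraction datum.
-/
import Literature.NumberTheory.Rogawski1990.U3SupercuspidalJacquetVanishing   -- ★ the Φ₃ model being ported (+ cone: Iwahori factorisation, congruence subgroups, `zpowDiagGL`, `projector_eq_average`)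
import HarnessLib

/-!
# K2·E1 — `K2E1UnitaryTwoTorusContraction`: Casselman's torus-contraction datum for the quasi-split `U(σ, Φ_n)(K)` in GENERAL rank, and the
# rank-two torus family `a_N = d(ϖ^N, ϖ^{-N}) ∈ U(σ, Φ₂)` with its escape from `C · Z` (satellite of `K2E1SupercuspidalJacquetVanishingU2`)

Track B ∕ K2-LIT, crux h413 = `stmt-HodgeConjecture-24833`, route of record `HCCMUnconditional`; cell `hodgecm-mathlib`, squad K2; prover seat
`hodgecm-mathlib-K2E1-p04` (g2), BY-NAME DEAL of the dealer K2E1-plan (g0) 2026-09-03T22:23:49Z; lane `--supports stmt-HodgeConjecture-24833 --as helper`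
(count-neutral).  THEOREMS ONLY (no `def`, no `instance`, no notation, no named-fact hypothesis, no `sorry`).

WHAT AND WHY.  The tree PROVES Harish-Chandra's criterion ⇒ («supercuspidal ⇒ Jacquet module vanishes») for the quasi-split `U(3)` (★
`UnitaryGroup.coinvariants_subsingleton_of_isSupercuspidal`, `U3SupercuspidalJacquetVanishing`) by Casselman's Haar-free argument [Casselman1995 Thm. 5.3.1,
Prop. 1.4.4; BernsteinZelevinsky1976 Thm. 3.21].  Its ingredients in ★ `UnitaryGroupCongruenceIwahoriFactorisation` are GENERIC in the rank `n` for the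
Iwahori factorisation of `K_γ ∩ U(σ, Φ_n)` (★ `exists_unitriangular_mul_lower_of_mem_unitary_congruenceGL`), the unitarity of `ϖ^a` (★
`zpowDiagGL_mem_unitaryGroupOfForm_of_eq`) and the contraction of `K_γ ∩ B⁻` (★ `zpowDiagGL_inv_mul_mul_mem_congruenceGL`), but are STATED FOR `Fin 3` in
its §4 (the averaging step, the torus family `d(ϖ^N, 1, ϖ^{-N})`, the escape from `C · Z`, the iteration on the Jacquet module) and in the projector lemma
of `U3SupercuspidalJacquetVanishing`.  The live socket 5R of the line `K2_E1_TraceFormulaBeta` needs the RANK-TWO case `U(Φ₂) = U(1,1)`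
[Rogawski1990 §13.8 p. 218: the globalisation on `H = U(2) × U(1)`].  This satellite re-types those §4 statements in GENERAL `n` (proofs = the ★ proofs with
`3 ↦ n`, verbatim otherwise — adapted from ★ `UnitaryGroupCongruenceIwahoriFactorisation` §4 and ★ `U3SupercuspidalJacquetVanishing` §1) and supplies
the two genuinely rank-dependent pieces for `n = 2`: the torus family `a_N = d(ϖ^N, ϖ^{-N})` (exponent vector `i ↦ N(1 − 2i)`, antitone, antisymmetric
under `i ↦ 1 − i`, so `a_N ∈ U(σ, Φ₂)` for `σ ϖ = ϖ`) and its escape from `C · Z` (`g ↦ (g⁻¹)₀₀ g₁₁` equals `ϖ^{-2N}` at `a_N`).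

* §1 (general `n`): `isCompact_isOpen_unitaryCongruence` (`K_γ ∩ U` compact open), `coinvariants_mk_apply_apply_eq_of_mem_unitaryCongruence` (the AVERAGING
  STEP `[ρ(k) ρ(t) w] = [ρ(t) w]` in `V_N` for `k ∈ K_γ ∩ U`, `t = ϖ^a` antitone, `w` `K_γ ∩ U`-fixed),
  `coinvariants_mk_projector_apply_eq_of_unitaryCongruence` (the projector onto `V^{K_γ ∩ U}` is invisible in `V_N` on `ρ(t) w`); the iteration
  `(r_B(a_1))^N [x] = [ρ(a_N) x]` is done inline by the consumer (★ `Representation.jacquetModule_mk`).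
* §2 (`n = 2`): **`exists_torusU_family_two`**, **`exists_forall_torusTwo_not_mem_mul_of_forall_eq_scalar`**.

HONEST LABEL: HC_CM is proved only modulo the 7 printed citations (2 remaining named inputs: hLiu418 = `stmt-HodgeConjecture-24832`, h413 =
`stmt-HodgeConjecture-24833`) until rung 0 closes; this file moves no counter.

## References
* [Casselman1995] W. Casselman, *Introduction to the theory of admissible representations of p-adic reductive groups* (1995), Prop. 1.4.4, Thm. 5.3.1.
* [BernsteinZelevinsky1976] I. N. Bernstein, A. V. Zelevinsky, *Representations of the group GL(n, F)*, Russian Math. Surveys 31:3 (1976), §3.18–3.21.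
* [BernsteinZelevinsky1977] I. N. Bernstein, A. V. Zelevinsky, *Induced representations of reductive p-adic groups I*, Ann. Sci. ÉNS 10 (1977), §1.8.
* [Rogawski1990] J. D. Rogawski, *Automorphic Representations of Unitary Groups in Three Variables*, Ann. of Math. Stud. 123 (1990), §1.10 p. 9 (`B = MN`,
  the diagonal torus), §12.2 p. 173, §13.8 p. 218.
-/

set_option autoImplicit false
-- the mandated namespace repeats the single-problem summit's segment (`HodgeConjecture.HodgeConjecture`)
set_option linter.dupNamespace false

open scoped MatrixGroups Pointwise Topology
open ValuativeRel Matrix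
open Literature.NumberTheory.Automorphic Literature.NumberTheory.Automorphic.UnitaryGroup

namespace Summit.HodgeConjecture.HodgeConjecture.Cruxes.H413.K2E1UnitaryTwoTorusContraction

/-! ## §1 The torus-contraction datum of `U(σ, Φ_n)(K)` in general rank (★ §4 of `UnitaryGroupCongruenceIwahoriFactorisation` with `3 ↦ n`) -/

section Model

variable {K : Type*} [Field K] [ValuativeRel K] [TopologicalSpace K] [IsNonarchimedeanLocalField K]
  (σ : K →+* K) {n : ℕ} {J : Matrix (Fin n) (Fin n) K} (hJ : J = (StdForm.antidiagonal n).over K)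
  {V : Type*} [AddCommGroup V] [Module ℂ V]

/-- The trace `K_γ ∩ U` on `U = U(σ, J)` of a principal congruence subgroup of `GL_n(K)` is compact and open (closed embedding `U ↪ GL_n(K)`; ★
`isCompact_congruenceGL`, ★ `isOpen_congruenceGL`) — ★ `UnitaryGroup.isCompact_isOpen_comap_congruenceGL` is the case `n = 3`, same proof.
[cite: Casselman1995, §1.4, Prop. 1.4.4] -/
theorem isCompact_isOpen_unitaryCongruence (hσc : Continuous σ) {γ : ValueGroupWithZero K} (hγ : γ ≠ 0) :
    IsCompact (((congruenceGL n γ).comap (unitaryGroupOfForm σ J).subtype : Subgroup ↥(unitaryGroupOfForm σ J)) : Set ↥(unitaryGroupOfForm σ J)) ∧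
      IsOpen (((congruenceGL n γ).comap (unitaryGroupOfForm σ J).subtype : Subgroup ↥(unitaryGroupOfForm σ J)) : Set ↥(unitaryGroupOfForm σ J)) := by
  haveI : T2Space K := (Literature.NumberTheory.GaloisRepresentations.IsNonarchimedeanLocalField.isLocalField K).toT2Space
  have hcl : IsClosed (unitaryGroupOfForm σ J : Set (GL (Fin n) K)) := isClosed_unitaryGroupOfForm hσc J
  exact ⟨hcl.isClosedEmbedding_subtypeVal.isCompact_preimage (isCompact_congruenceGL γ), (isOpen_congruenceGL hγ).preimage continuous_subtype_val⟩

omit [TopologicalSpace K] [IsNonarchimedeanLocalField K] in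
/-- **The averaging step, general rank** (adapted from ★ `UnitaryGroup.coinvariants_mk_apply_apply_eq_of_mem_congruenceGL`, `3 ↦ n`).  For `γ < 1`, an
antitone exponent vector `a` with `t = ϖ^a ∈ U` (`|ϖ| ≤ 1`), a vector `w` fixed by `K_γ ∩ U` and `k ∈ K_γ ∩ U`: `[ρ(k) ρ(t) w] = [ρ(t) w]` in the Jacquet
module `V_N` — write `k = u b` (★ Iwahori factorisation: `u ∈ N`, `b ∈ B⁻ ∩ K_γ ∩ U`), so `ρ(k)ρ(t)w = ρ(u) ρ(t) ρ(t⁻¹ b t) w = ρ(u) ρ(t) w` (★ contraction: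
`t⁻¹ b t ∈ K_γ`) and `u` acts trivially on `V_N`. [cite: Casselman1995, Thm. 5.3.1, Prop. 1.4.4] -/
theorem coinvariants_mk_apply_apply_eq_of_mem_unitaryCongruence {γ : ValueGroupWithZero K} (hγ : γ < 1)
    {ϖ : K} (hϖ0 : ϖ ≠ 0) (hϖ1 : valuation K ϖ ≤ 1) {a : Fin n → ℤ} (ha : Antitone a)
    (t : ↥(unitaryGroupOfForm σ J)) (ht : ((t : ↥(unitaryGroupOfForm σ J)) : GL (Fin n) K) = zpowDiagGL hϖ0 a)
    (ρ : Representation ℂ ↥(unitaryGroupOfForm σ J) V) {w : V}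
    (hw : ∀ g ∈ (congruenceGL n γ).comap (unitaryGroupOfForm σ J).subtype, ρ g w = w)
    {k : ↥(unitaryGroupOfForm σ J)} (hk : k ∈ (congruenceGL n γ).comap (unitaryGroupOfForm σ J).subtype) :
    Representation.Coinvariants.mk ((borelTriple σ J hJ).restrict ρ) (ρ k (ρ t w)) =
      Representation.Coinvariants.mk ((borelTriple σ J hJ).restrict ρ) (ρ t w) := by
  have hkGL : (k : GL (Fin n) K) ∈ congruenceGL n γ := hk
  obtain ⟨u, b, huU, hbU, hu, hb, -, hbK, hkub⟩ := exists_unitriangular_mul_lower_of_mem_unitary_congruenceGL σ hγ hJ k.2 hkGL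
  have hconjGL := zpowDiagGL_inv_mul_mul_mem_congruenceGL hϖ0 hϖ1 hγ ha hb hbK
  have hkeq : k = (⟨u, huU⟩ : ↥(unitaryGroupOfForm σ J)) * ⟨b, hbU⟩ := Subtype.ext hkub
  have hconj : t⁻¹ * (⟨b, hbU⟩ : ↥(unitaryGroupOfForm σ J)) * t ∈ (congruenceGL n γ).comap (unitaryGroupOfForm σ J).subtype := by
    show ((t⁻¹ * (⟨b, hbU⟩ : ↥(unitaryGroupOfForm σ J)) * t : ↥(unitaryGroupOfForm σ J)) : GL (Fin n) K) ∈ congruenceGL n γ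
    rw [Subgroup.coe_mul, Subgroup.coe_mul, Subgroup.coe_inv, ht]
    exact hconjGL
  have huN : (⟨u, huU⟩ : ↥(unitaryGroupOfForm σ J)) ∈ (borelTriple σ J hJ).N := hu
  have h1 : ρ k (ρ t w) = ρ (⟨u, huU⟩ : ↥(unitaryGroupOfForm σ J)) (ρ t (ρ (t⁻¹ * (⟨b, hbU⟩ : ↥(unitaryGroupOfForm σ J)) * t) w)) := by
    rw [hkeq, ← Module.End.mul_apply, ← MonoidHom.map_mul, ← Module.End.mul_apply, ← MonoidHom.map_mul, ← Module.End.mul_apply,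
      ← MonoidHom.map_mul]
    congr 1
    group
  rw [h1, hw _ hconj]
  exact Representation.Coinvariants.mk_self_apply ((borelTriple σ J hJ).restrict ρ)
    ⟨⟨(⟨u, huU⟩ : ↥(unitaryGroupOfForm σ J)), (borelTriple σ J hJ).N_le huN⟩, huN⟩ _

/-- **The projector onto the `K_γ ∩ U`-fixed vectors is invisible in the Jacquet module on `ρ(t) w`, general rank** (adapted from ★
`UnitaryGroup.coinvariants_mk_projector_apply_eq`, `3 ↦ n`): for `γ < 1`, `t = ϖ^a ∈ U` (`a` antitone, `|ϖ| ≤ 1`), `w` fixed by `K_γ ∩ U` and a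
`K_γ ∩ U`-invariant projector `e` onto `V^{K_γ ∩ U}`: `[e (ρ(t) w)] = [ρ(t) w]` — `e` is the normalised finite average over `(K_γ ∩ U) ⧸ L` (★
`projector_eq_average`), and every term `[ρ(k) ρ(t) w]` equals `[ρ(t) w]` (averaging step). [cite: Casselman1995, Thm. 5.3.1] [cite: BernsteinZelevinsky1976, Thm. 3.21] -/
theorem coinvariants_mk_projector_apply_eq_of_unitaryCongruence (hσc : Continuous σ) {γ : (ValueGroupWithZero K)ˣ} (hγ : (γ : ValueGroupWithZero K) < 1)
    {ϖ : K} (hϖ0 : ϖ ≠ 0) (hϖ1 : valuation K ϖ ≤ 1) {aE : Fin n → ℤ} (ha : Antitone aE)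
    (t : ↥(unitaryGroupOfForm σ J)) (haa : ((t : ↥(unitaryGroupOfForm σ J)) : GL (Fin n) K) = zpowDiagGL hϖ0 aE)
    (ρ : Representation ℂ ↥(unitaryGroupOfForm σ J) V) (hρ : ρ.IsSmooth) {w : V}
    (hw : ∀ g ∈ (congruenceGL n (γ : ValueGroupWithZero K)).comap (unitaryGroupOfForm σ J).subtype, ρ g w = w)
    (e : V →ₗ[ℂ] V) (he₂ : ∀ v ∈ ρ.fixedPoints ((congruenceGL n (γ : ValueGroupWithZero K)).comap (unitaryGroupOfForm σ J).subtype), e v = v)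
    (he₃ : ∀ g ∈ (congruenceGL n (γ : ValueGroupWithZero K)).comap (unitaryGroupOfForm σ J).subtype, ∀ v, e (ρ g v) = e v) :
    Representation.Coinvariants.mk ((borelTriple σ J hJ).restrict ρ) (e (ρ t w)) =
      Representation.Coinvariants.mk ((borelTriple σ J hJ).restrict ρ) (ρ t w) := by
  classical
  obtain ⟨hKc, -⟩ := isCompact_isOpen_unitaryCongruence σ (J := J) hσc (Units.ne_zero γ)
  haveI : CompactSpace ↥((congruenceGL n (γ : ValueGroupWithZero K)).comap (unitaryGroupOfForm σ J).subtype) :=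
    isCompact_iff_compactSpace.mp hKc
  obtain ⟨L, hL⟩ := hρ.exists_openNormalSubgroup_forall_apply_eq
    ((congruenceGL n (γ : ValueGroupWithZero K)).comap (unitaryGroupOfForm σ J).subtype) (ρ t w)
  haveI : Fintype (↥((congruenceGL n (γ : ValueGroupWithZero K)).comap (unitaryGroupOfForm σ J).subtype) ⧸ L.toSubgroup) :=
    Fintype.ofFinite _
  rw [projector_eq_average ρ e he₂ he₃ L.toSubgroup hL, map_smul, map_sum]
  have hconst : ∀ r : ↥((congruenceGL n (γ : ValueGroupWithZero K)).comap (unitaryGroupOfForm σ J).subtype) ⧸ L.toSubgroup,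
      Representation.Coinvariants.mk ((borelTriple σ J hJ).restrict ρ)
          (ρ ((r.out : ↥((congruenceGL n (γ : ValueGroupWithZero K)).comap (unitaryGroupOfForm σ J).subtype)) :
            ↥(unitaryGroupOfForm σ J)) (ρ t w)) =
        Representation.Coinvariants.mk ((borelTriple σ J hJ).restrict ρ) (ρ t w) := fun r =>
    coinvariants_mk_apply_apply_eq_of_mem_unitaryCongruence σ hJ hγ hϖ0 hϖ1 ha t haa ρ hw (r.out).2
  simp only [hconst, Finset.sum_const, Finset.card_univ]
  rw [← Nat.cast_smul_eq_nsmul ℂ, smul_smul, inv_mul_cancel₀ (Nat.cast_ne_zero.2 Fintype.card_ne_zero), one_smul]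

end Model

/-! ## §2 The rank-two torus family `a_N = d(ϖ^N, ϖ^{-N}) ∈ U(σ, Φ₂)` and its escape from `C · Z` -/

section Two

variable {K : Type*} [Field K] [ValuativeRel K] [TopologicalSpace K] [IsNonarchimedeanLocalField K]
  (σ : K →+* K) {J : Matrix (Fin 2) (Fin 2) K} (hJ : J = (StdForm.antidiagonal 2).over K)

omit [ValuativeRel K] [TopologicalSpace K] [IsNonarchimedeanLocalField K] in
/-- **The torus elements `a_N = d(ϖ^N, ϖ^{-N}) ∈ T ≤ U(σ, Φ₂)`** for a `σ`-fixed `ϖ ≠ 0`, as a multiplicative family `a_{N+1} = a_N a_1`, `a_0 = 1`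
(exponent vector `i ↦ N(1 − 2i)` on `Fin 2`, antitone and antisymmetric under `i ↦ 1 − i`; unitary by ★ `zpowDiagGL_mem_unitaryGroupOfForm_of_eq`) — the
rank-two twin of ★ `UnitaryGroup.exists_torusU_family` (`d(ϖ^N, 1, ϖ^{-N}) ∈ U(Φ₃)`). [cite: Rogawski1990, §1.10 p. 9] [cite: Casselman1995, Prop. 1.4.4] -/
theorem exists_torusU_family_two {ϖ : K} (hϖ0 : ϖ ≠ 0) (hσϖ : σ ϖ = ϖ) :
    ∃ a : ℕ → ↥(unitaryGroupOfForm σ J),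
      (∀ N, ((a N : ↥(unitaryGroupOfForm σ J)) : GL (Fin 2) K) = zpowDiagGL hϖ0 (fun i : Fin 2 => (N : ℤ) * (1 - 2 * (i.val : ℤ)))) ∧
      (∀ N, a (N + 1) = a N * a 1) ∧ a 0 = 1 ∧ (∀ N, a N ∈ (borelTriple σ J hJ).M) ∧
      ∀ N : ℕ, Antitone (fun i : Fin 2 => (N : ℤ) * (1 - 2 * (i.val : ℤ))) := by
  have haE_rev : ∀ (N : ℕ) (i : Fin 2), (N : ℤ) * (1 - 2 * ((Fin.rev i).val : ℤ)) + (N : ℤ) * (1 - 2 * (i.val : ℤ)) = 0 := by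
    intro N i
    have h2 : ((Fin.rev i).val : ℤ) + (i.val : ℤ) = 1 := by
      have h := Fin.val_rev i
      have hi := i.isLt
      omega
    linear_combination (-(2 : ℤ) * (N : ℤ)) * h2
  have haE_anti : ∀ N : ℕ, Antitone (fun i : Fin 2 => (N : ℤ) * (1 - 2 * (i.val : ℤ))) := by
    intro N i j hij
    have h2 : (i.val : ℤ) ≤ (j.val : ℤ) := by exact_mod_cast hij
    have hN : (0 : ℤ) ≤ N := Int.natCast_nonneg N
    show (N : ℤ) * (1 - 2 * (j.val : ℤ)) ≤ (N : ℤ) * (1 - 2 * (i.val : ℤ))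
    nlinarith
  have haU : ∀ N : ℕ, zpowDiagGL hϖ0 (fun i : Fin 2 => (N : ℤ) * (1 - 2 * (i.val : ℤ))) ∈ unitaryGroupOfForm σ J := fun N =>
    zpowDiagGL_mem_unitaryGroupOfForm_of_eq σ hϖ0 hσϖ hJ (haE_rev N)
  refine ⟨fun N => ⟨_, haU N⟩, fun N => rfl, fun N => ?_, ?_, fun N => ?_, haE_anti⟩
  · apply Subtype.ext
    rw [Subgroup.coe_mul]
    show zpowDiagGL hϖ0 _ = zpowDiagGL hϖ0 _ * zpowDiagGL hϖ0 _
    rw [← zpowDiagGL_add]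
    congr 1
    funext i
    simp only [Pi.add_apply]
    push_cast
    ring
  · apply Subtype.ext
    rw [Subgroup.coe_one]
    show zpowDiagGL hϖ0 _ = 1
    have h0 : (fun i : Fin 2 => ((0 : ℕ) : ℤ) * (1 - 2 * (i.val : ℤ))) = 0 := by funext i; simp
    rw [h0, zpowDiagGL_zero]
  · rw [borelTriple_M, mem_torusU_iff]
    refine ⟨fun i => Units.mk0 ϖ hϖ0 ^ ((N : ℤ) * (1 - 2 * (i.val : ℤ))), Units.ext ?_⟩
    rw [coe_glDiagonal]
    show (Matrix.diagonal fun i => (((Units.mk0 ϖ hϖ0 ^ ((N : ℤ) * (1 - 2 * (i.val : ℤ))) : Kˣ)) : K)) =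
      ((zpowDiagGL hϖ0 (fun i : Fin 2 => (N : ℤ) * (1 - 2 * (i.val : ℤ))) : GL (Fin 2) K) : Matrix (Fin 2) (Fin 2) K)
    rw [coe_zpowDiagGL]
    congr 1
    funext i
    simp

/-- **The torus elements `d(ϖ^N, ϖ^{-N})` eventually leave `C · Z`** for every compact `C ⊆ GL₂(K)` and every set `Z` of SCALAR matrices: the continuous
function `g ↦ (g⁻¹)₀₀ · g₁₁` is invariant under right multiplication by scalars, bounded in valuation on `C`, and equals `ϖ^{-2N}` at `d(ϖ^N, ϖ^{-N})` — the
rank-two twin of ★ `UnitaryGroup.exists_forall_zpowDiagGL_not_mem_mul_of_forall_eq_scalar`. [cite: Casselman1995, proof of Thm. 5.3.1] [cite: BernsteinZelevinsky1976, §3.18–3.21] -/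
theorem exists_forall_torusTwo_not_mem_mul_of_forall_eq_scalar {ϖ : K} (hϖ0 : ϖ ≠ 0) (hϖ1 : valuation K ϖ < 1)
    {C : Set (GL (Fin 2) K)} (hC : IsCompact C) {Z : Set (GL (Fin 2) K)}
    (hZ : ∀ z ∈ Z, ∃ u : Kˣ, z = Matrix.GeneralLinearGroup.scalar (Fin 2) u) :
    ∃ N₀ : ℕ, ∀ N : ℕ, N₀ ≤ N →
      zpowDiagGL hϖ0 (fun i : Fin 2 => (N : ℤ) * (1 - 2 * (i.val : ℤ))) ∉ C * Z := by
  set f : GL (Fin 2) K → K := fun g =>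
    ((g⁻¹ : GL (Fin 2) K) : Matrix (Fin 2) (Fin 2) K) 0 0 * (g : Matrix (Fin 2) (Fin 2) K) 1 1 with hfdef
  have hf : Continuous f :=
    (Units.continuous_coe_inv.matrix_elem 0 0).mul (Units.continuous_val.matrix_elem 1 1)
  obtain ⟨γ, hγ⟩ := exists_forall_valuation_le_of_isCompact (hC.image hf)
  have hvϖ0 : valuation K ϖ ≠ 0 := (Valuation.ne_zero_iff _).2 hϖ0
  obtain ⟨N₀, hN₀⟩ := exists_forall_lt_zpow_neg hvϖ0 hϖ1 γ
  refine ⟨N₀, fun N hN hmem => ?_⟩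
  obtain ⟨g, hg, z, hz, hgz⟩ := Set.mem_mul.1 hmem
  obtain ⟨u, rfl⟩ := hZ z hz
  -- `f` is invariant under the scalars
  have hfz : f (g * Matrix.GeneralLinearGroup.scalar (Fin 2) u) = f g := by
    simp only [hfdef, _root_.mul_inv_rev, Units.val_mul, ← map_inv, Matrix.GeneralLinearGroup.coe_scalar,
      Matrix.scalar_apply, Matrix.diagonal_mul, Matrix.mul_diagonal]
    rw [Units.val_inv_eq_inv_val]
    field_simp
  -- the value at the torus element
  have hft : f (zpowDiagGL hϖ0 (fun i : Fin 2 => (N : ℤ) * (1 - 2 * (i.val : ℤ)))) = ϖ ^ (-(N : ℤ)) * ϖ ^ (-(N : ℤ)) := by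
    simp only [hfdef]
    rw [← zpowDiagGL_neg, coe_zpowDiagGL, coe_zpowDiagGL, Matrix.diagonal_apply_eq, Matrix.diagonal_apply_eq, Pi.neg_apply]
    norm_num
  have h1 : valuation K (f (zpowDiagGL hϖ0 (fun i : Fin 2 => (N : ℤ) * (1 - 2 * (i.val : ℤ))))) ≤ γ := by
    rw [← hgz, hfz]
    exact hγ _ ⟨g, hg, rfl⟩
  rw [hft, map_mul, map_zpow₀] at h1
  have h2 : valuation K ϖ ^ (-(N : ℤ)) ≤ valuation K ϖ ^ (-(N : ℤ)) * valuation K ϖ ^ (-(N : ℤ)) := by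
    have hge : 1 ≤ valuation K ϖ ^ (-(N : ℤ)) := by
      rw [_root_.zpow_neg, zpow_natCast]
      exact one_le_inv_iff₀.2 ⟨pow_pos (zero_lt_iff.2 hvϖ0) N, pow_le_one' hϖ1.le N⟩
    exact le_mul_of_one_le_right' hge
  exact absurd (h2.trans h1) (not_le.2 (hN₀ N hN))

end Two

end Summit.HodgeConjecture.HodgeConjecture.Cruxes.H413.K2E1UnitaryTwoTorusContraction
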